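import Summits.BirchSwinnertonDyer.BirchSwinnertonDyer.Theorems.ByReductionTypeAtTwoSupersingularFlatReciprocityConstant
import HarnessLib

/-!
# Crux `SupersingularRankZeroAtTwo` (K4, item stmt-BirchSwinnertonDyer-19097), line `odd_blind_package` v2.20, `stub_flatPackage`
# conjunct (8), F3b — FILE B1b of hand «(B1)♭-DECIDE»: THE ♭ RECIPROCITY CONSTANT ON THE HABITAT (`p = 2`, Z6's literal binders) —
# (B1)♭ is «`v₂(ϖ) ≥ 0`», `h2` is ♭-primitivity of the family

Seat `bsd-2adic-tower-1` GEN 70 (pen GEN 41 SUMMON 20260831T234826Z, LEAD ss-1 GEN 26 notes (N1)–(N3)). HONEST FRAMING: theorems only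
(no definition, no named fact, no instance, no `sorry`); helper toward the displayed residue of conjunct (8) F3b of `stub_flatPackage`;
closes no stub and no item; 19097 OPEN; BSD₂ is proved for no supersingular curve and BSD for no curve by any of this.

## What (companion of `…FlatReciprocityConstant.lean`, §1–§2 there)

In the LITERAL binders of the assembly Z6 (`SSFlatPackage.flatF3_package_of_levelCongruences`: habitat curve `W`, cyclotomic `κ`, `v`,
Honda data `(g, c)` through `hJ`, pin `I`, `L`, `J`, `P`/`loc`, newform `f`, period ratio `ϖ : ℚ`, Sprung pair `(Ls, Lf)`, family
`(x, A)`, `d ≠ 0`, `hE3`, `hcop`, `h2`):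
* ★★ `flatF3_package_of_levelCongruences_of_padicValRat_nonneg` — Z6 with its displayed `(t : ℤ_[2]) (ht : ↑t = ϖ·d)` REPLACED by
  `hϖ : 0 ≤ padicValRat 2 ϖ` («`ϖ = Ω⁺_f/Ω_W` is `2`-integral»): same conclusion F3a ∧ F3b ∧ ZL2, token for token (sufficiency; needs
  neither `h2` nor `μ`).
* ★ `isUnit_d_of_h2` — under `h2` and `μ(L♭) = 0` (`Lf ∉ (2)`), `d` is a `2`-adic UNIT; ★ `exists_t_iff_padicValRat_nonneg_of_h2` — hence
  a displayed `t` EXISTS IFF `0 ≤ v₂(ϖ)`, and `v₂(t) = v₂(ϖ)`: (B1)♭ DECIDED relative to `h2` — it is «`v₂(ϖ) ≥ 0`»; on the habitat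
  (`#Ẽ(𝔽₂) = 3 − a₂` odd ⇒ odd isogeny degrees ⇒ `v₂(Ω_{E₀}/Ω_W) = 0`) this reads «the Manin constant `c₀` of the optimal curve is odd»
  (numbers: the seat's census memo, not a theorem here).
* ★ `h2_iff_flatPrimitive` — under `μ(L♭) = 0`, `h2` yields a class `x_δ` with `(J (L x_δ)).2 ∉ (2)` and `A_δ ∉ (2) ⟺ (J (L x_δ)).2 ∉ (2)`
  for every `δ`: `h2` IS «some Kato class of the family is ♭-PRIMITIVE at `2`» — `q`, `D`, `N`, `q.num`, `q.den` of the E5 normalisation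
  (`A_δ = C(N·q.num)·μ̃_δ`, `d = D·q.den`) do not occur.

References: [Kato2004Asterisque] Thm. 12.4 (2)(3), Thm. 12.5 (1)(4), Thm. 12.6, §13.9, §13.12–13.14 (pp. 221–234); [Sprung2017] Thm. 1.12,
Cor. 4.4–4.5; [Sprung2012] Def. 7.1, Thm. 7.14, 7.16; [Washington1997] §13.1–13.2.
-/

set_option autoImplicit false
-- the Theorems namespace of this sub repeats the summit name by design (D-0017 nested layout)
set_option linter.dupNamespace false

noncomputable section

open scoped Classical NumberField

open Polynomial

namespace Summit.BirchSwinnertonDyer.BirchSwinnertonDyer.Theorems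

namespace SSFlatERL

open NumberField IsDedekindDomain WeierstrassCurve Literature.NumberTheory.EllipticCurves
  Literature.NumberTheory.EllipticCurves.ZpExtension Literature.NumberTheory.EllipticCurves.Sprung2017
  Literature.NumberTheory.EllipticCurves.Kobayashi2003 Literature.NumberTheory.EllipticCurves.Sprung2012
  Literature.NumberTheory.EllipticCurves.Rank1Residual Literature.NumberTheory.GaloisRepresentations CongruenceSubgroup
  SSFlatPackage
open Literature.NumberTheory.EllipticCurves.IwasawaAlgebra

/-! ## §3 The habitat (`p = 2`): (B1)♭ is «`v₂(ϖ) ≥ 0`» -/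

section Habitat

variable (W : WeierstrassCurve ℚ) [W.IsElliptic] [W.IsGloballyMinimal] [ContinuousSMul ℤ_[2] (W.tateModule 2)]
  [Module.Free ℤ_[2] (W.tateModule 2)] [Module.Finite ℤ_[2] (W.tateModule 2)]
  {κ : ZpExtension ℚ 2} {γ : Field.absoluteGaloisGroup ℚ} (v : HeightOneSpectrum (𝓞 ℚ))
  {g : Field.absoluteGaloisGroup (v.adicCompletion ℚ)} {c : ℕ → localPoints W (v.adicCompletion ℚ)}

/-- ★★ **F3a ∧ F3b ∧ ZL2 OF CONJUNCT (8) WITH (B1)♭ IN INVARIANT FORM.**  VERBATIM the assembly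
`SSFlatPackage.flatF3_package_of_levelCongruences` (Z6) with its displayed `(t : ℤ_[2]) (ht : ↑t = ϖ·d)` REPLACED by
`hϖ : 0 ≤ padicValRat 2 ϖ` — «the period ratio `ϖ` (`ϖ·Ω_W = Ω⁺_f`) is `2`-integral»; `t := ϖ·d` then exists for any `d ∈ ℤ₂`
(`exists_padicInt_coe_eq_mul_of_padicValRat_nonneg`).  Same conclusion, token for token.
[cite: Kato2004Asterisque, Thm. 12.4 (2)(3) (p. 221), Thm. 12.5 (4), Thm. 12.6 (p. 222), §13.9, §13.12–13.14 (pp. 230–234)]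
[cite: Sprung2012, Def. 7.1 (p. 1500), Thm. 7.14, 7.16] [cite: Sprung2017, Thm. 1.12, Cor. 4.4–4.5] -/
theorem flatF3_package_of_levelCongruences_of_padicValRat_nonneg (hss : GoodSS W 2) (hκ : κ.IsCyclotomic)
    (hγ : κ.IsTopGenerator γ)
    (hg : κ.IsTopGenerator (resGalOfEmb (closureEmb (K := ℚ) (v.adicCompletion ℚ)) g)) {ap : ℤ} (hap : (2 : ℤ) ∣ ap)
    (I : Kato2004.IwasawaH1Data W 2 κ γ) (hrank : Module.rank (IwasawaAlgebra 2) I.H ≤ 1)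
    (L : letI := moduleOfGenerator κ (closureEmb (K := ℚ) (v.adicCompletion ℚ)) W hg
      I.H →ₗ[IwasawaAlgebra 2] (localTowerPointsOfEmb κ (closureEmb (K := ℚ) (v.adicCompletion ℚ)) W →+ ℤ_[2]))
    (J : letI := moduleOfGenerator κ (closureEmb (K := ℚ) (v.adicCompletion ℚ)) W hg
      (localTowerPointsOfEmb κ (closureEmb (K := ℚ) (v.adicCompletion ℚ)) W →+ ℤ_[2]) →ₗ[IwasawaAlgebra 2]
        IwasawaAlgebra 2 × IwasawaAlgebra 2)
    (hJ : ∀ w, IsColemanPair κ (closureEmb (K := ℚ) (v.adicCompletion ℚ)) W ap g c w (J w).1 (J w).2)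
    (P : Submodule (IwasawaAlgebra 2) (IwasawaAlgebra 2)) (loc : I.H →ₗ[IwasawaAlgebra 2] P)
    (hloc : ∀ x : I.H, (loc x : IwasawaAlgebra 2) = (J (L x)).2)
    {N : ℕ} (f : CuspForm (Gamma0 N) 2) (ϖ : ℚ) (Ls Lf : IwasawaAlgebra 2) (hL : IsSprungPair f 2 ap Ls Lf) (hLf : Lf ≠ 0)
    {ι : Type*} (x : ι → I.H) (A : ι → IwasawaAlgebra 2) {d : ℤ_[2]} (hd : d ≠ 0)
    (hE3 : ∀ (i : ι) (n : ℕ), ∃ (m : ℕ) (q : IwasawaAlgebra 2), PowerSeries.C ((2 : ℚ_[2]) ^ m) *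
        (iwasawaToPowerSeries 2 (A i) * (((mazurTateElement f 2 n).map (algebraMap ℚ ℚ_[2]) : ℚ_[2][X]) : PowerSeries ℚ_[2]) -
          iwasawaToPowerSeries 2 (PowerSeries.C d *
            pairingSum W (localTowerPointsOfEmb κ (closureEmb (K := ℚ) (v.adicCompletion ℚ)) W) g n (c n) (L (x i)))) =
      iwasawaToPowerSeries 2 ((((cyclotomicOmega 2 n).map (Int.castRingHom ℤ_[2]) : ℤ_[2][X]) : PowerSeries ℤ_[2]) * q))
    (hcop : ∀ 𝔭 : PrimeSpectrum (IwasawaAlgebra 2), 𝔭.asIdeal.height = 1 →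
      PowerSeries.C (2 : ℤ_[2]) ∉ 𝔭.asIdeal → ∃ i, A i ∉ 𝔭.asIdeal ∧
        Literature.NumberTheory.EllipticCurves.Kato2004.IsEulerSystemClassTwo W hκ I (x i) ∧ x i ≠ 0)
    (h2 : ∀ 𝔭 : PrimeSpectrum (IwasawaAlgebra 2), 𝔭.asIdeal.height = 1 →
      PowerSeries.C (2 : ℤ_[2]) ∈ 𝔭.asIdeal → ∃ i, A i ∉ 𝔭.asIdeal)
    (hϖ : 0 ≤ padicValRat 2 ϖ) :
    ∃ (Z : Submodule (IwasawaAlgebra 2) I.H) (G : IwasawaAlgebra 2),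
      G ∈ Submodule.map (P.subtype ∘ₗ loc) Z ∧
      iwasawaToPowerSeries 2 G = PowerSeries.C (ϖ : ℚ_[2]) * iwasawaToPowerSeries 2 Lf ∧
      (∃ s₀ : I.H, Z = Submodule.span (IwasawaAlgebra 2) {s₀} ∧
        ∀ 𝔭 : PrimeSpectrum (IwasawaAlgebra 2), 𝔭.asIdeal.height = 1 →
          PowerSeries.C (2 : ℤ_[2]) ∉ 𝔭.asIdeal →
          ∃ (M : IwasawaAlgebra 2) (s : I.H), M ∉ 𝔭.asIdeal ∧
            Literature.NumberTheory.EllipticCurves.Kato2004.IsEulerSystemClassTwo W hκ I s ∧ s ≠ 0 ∧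
            M • s₀ = s) := by
  obtain ⟨t, ht⟩ := exists_padicInt_coe_eq_mul_of_padicValRat_nonneg (p := 2) d hϖ
  exact flatF3_package_of_levelCongruences W v hss hκ hγ hg hap I hrank L J hJ P loc hloc f ϖ Ls Lf hL hLf x A hd hE3 hcop h2 t ht

omit [W.IsGloballyMinimal] in
/-- ★ **`d` IS A `2`-ADIC UNIT in the F3 assembly** as soon as `μ(L♭) = 0` (`hLμ : Lf ∉ (2)`): the displayed `h2`, the coprimality `hcop`
(its multiplier half) and the levelwise congruences force it (`isUnit_of_family` at `p = 2` in Z6's literal tokens).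
[cite: Kato2004Asterisque, Thm. 12.5 (4) (p. 222), §13.14 (p. 234)] [cite: Sprung2017, Thm. 1.12] -/
theorem isUnit_d_of_h2
    (hκ : κ.IsCyclotomic) (hg : κ.IsTopGenerator (resGalOfEmb (closureEmb (K := ℚ) (v.adicCompletion ℚ)) g)) {ap : ℤ} (hap : (2 : ℤ) ∣ ap)
    (I : Kato2004.IwasawaH1Data W 2 κ γ)
    (L : letI := moduleOfGenerator κ (closureEmb (K := ℚ) (v.adicCompletion ℚ)) W hg
      I.H →ₗ[IwasawaAlgebra 2] (localTowerPointsOfEmb κ (closureEmb (K := ℚ) (v.adicCompletion ℚ)) W →+ ℤ_[2]))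
    (J : letI := moduleOfGenerator κ (closureEmb (K := ℚ) (v.adicCompletion ℚ)) W hg
      (localTowerPointsOfEmb κ (closureEmb (K := ℚ) (v.adicCompletion ℚ)) W →+ ℤ_[2]) →ₗ[IwasawaAlgebra 2]
        IwasawaAlgebra 2 × IwasawaAlgebra 2)
    (hJ : ∀ w, IsColemanPair κ (closureEmb (K := ℚ) (v.adicCompletion ℚ)) W ap g c w (J w).1 (J w).2)
    {N : ℕ} (f : CuspForm (Gamma0 N) 2) (Ls Lf : IwasawaAlgebra 2) (hL : IsSprungPair f 2 ap Ls Lf)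
    {ι : Type*} (x : ι → I.H) (A : ι → IwasawaAlgebra 2) {d : ℤ_[2]} (hd : d ≠ 0)
    (hE3 : ∀ (i : ι) (n : ℕ), ∃ (m : ℕ) (q : IwasawaAlgebra 2), PowerSeries.C ((2 : ℚ_[2]) ^ m) *
        (iwasawaToPowerSeries 2 (A i) * (((mazurTateElement f 2 n).map (algebraMap ℚ ℚ_[2]) : ℚ_[2][X]) : PowerSeries ℚ_[2]) -
          iwasawaToPowerSeries 2 (PowerSeries.C d *
            pairingSum W (localTowerPointsOfEmb κ (closureEmb (K := ℚ) (v.adicCompletion ℚ)) W) g n (c n) (L (x i)))) =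
      iwasawaToPowerSeries 2 ((((cyclotomicOmega 2 n).map (Int.castRingHom ℤ_[2]) : ℤ_[2][X]) : PowerSeries ℤ_[2]) * q))
    (hcop : ∀ 𝔭 : PrimeSpectrum (IwasawaAlgebra 2), 𝔭.asIdeal.height = 1 →
      PowerSeries.C (2 : ℤ_[2]) ∉ 𝔭.asIdeal → ∃ i, A i ∉ 𝔭.asIdeal ∧
        Literature.NumberTheory.EllipticCurves.Kato2004.IsEulerSystemClassTwo W hκ I (x i) ∧ x i ≠ 0)
    (h2 : ∀ 𝔭 : PrimeSpectrum (IwasawaAlgebra 2), 𝔭.asIdeal.height = 1 →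
      PowerSeries.C (2 : ℤ_[2]) ∈ 𝔭.asIdeal → ∃ i, A i ∉ 𝔭.asIdeal)
    (hLμ : Lf ∉ augIdealP 2) : IsUnit d := by
  have hcop' : ∀ 𝔭 : PrimeSpectrum (IwasawaAlgebra 2), 𝔭.asIdeal.height = 1 →
      PowerSeries.C ((2 : ℕ) : ℤ_[2]) ∉ 𝔭.asIdeal → ∃ i, A i ∉ 𝔭.asIdeal := fun 𝔭 h𝔭 hm ↦ by
    obtain ⟨i, hi, -, -⟩ := hcop 𝔭 h𝔭 (by simpa using hm)
    exact ⟨i, hi⟩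
  have h2' : ∀ 𝔭 : PrimeSpectrum (IwasawaAlgebra 2), 𝔭.asIdeal.height = 1 →
      PowerSeries.C ((2 : ℕ) : ℤ_[2]) ∈ 𝔭.asIdeal → ∃ i, A i ∉ 𝔭.asIdeal := fun 𝔭 h𝔭 hm ↦ h2 𝔭 h𝔭 (by simpa using hm)
  have hE3' : ∀ (i : ι) (n : ℕ), ∃ (m : ℕ) (q : IwasawaAlgebra 2), PowerSeries.C (((2 : ℕ) : ℚ_[2]) ^ m) *
        (iwasawaToPowerSeries 2 (A i) * (((mazurTateElement f 2 n).map (algebraMap ℚ ℚ_[2]) : ℚ_[2][X]) : PowerSeries ℚ_[2]) -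
          iwasawaToPowerSeries 2 (PowerSeries.C d *
            pairingSum W (localTowerPointsOfEmb κ (closureEmb (K := ℚ) (v.adicCompletion ℚ)) W) g n (c n) (L (x i)))) =
      iwasawaToPowerSeries 2 ((((cyclotomicOmega 2 n).map (Int.castRingHom ℤ_[2]) : ℤ_[2][X]) : PowerSeries ℤ_[2]) * q) :=
    fun i n ↦ by simpa only [Nat.cast_ofNat] using hE3 i n
  exact isUnit_of_family hg (by simpa using hap) L J hJ x A hd hcop' h2' f hE3' hL hLμ

omit [W.IsGloballyMinimal] in
/-- ★ **(B1)♭ DECIDED RELATIVE TO `h2`: under `h2` and `μ(L♭) = 0`, a displayed `t : ℤ_[2]` with `t = ϖ·d` EXISTS IFF `0 ≤ v₂(ϖ)`,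
and then `v₂(t) = v₂(ϖ)`** — `q`, `D`, `N`, `q.num`, `q.den` of the E5/Z6 normalisation do not occur.  On the habitat `ϖ = Ω⁺_f/Ω_W =
Ω_{E₀}/(c₀·Ω_W)` with `E₀` the optimal curve and `c₀` its Manin constant, and all isogenies in the class have odd degree (`#Ẽ(𝔽₂) = 3 − a₂`
is odd), so this reads «`c₀` is odd» (census of the seat, not a theorem here).
[cite: Kato2004Asterisque, Thm. 12.5 (4) (p. 222), §13.14 (p. 234)] [cite: Sprung2017, Thm. 1.12] -/
theorem exists_t_iff_padicValRat_nonneg_of_h2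
    (hκ : κ.IsCyclotomic) (hg : κ.IsTopGenerator (resGalOfEmb (closureEmb (K := ℚ) (v.adicCompletion ℚ)) g)) {ap : ℤ} (hap : (2 : ℤ) ∣ ap)
    (I : Kato2004.IwasawaH1Data W 2 κ γ)
    (L : letI := moduleOfGenerator κ (closureEmb (K := ℚ) (v.adicCompletion ℚ)) W hg
      I.H →ₗ[IwasawaAlgebra 2] (localTowerPointsOfEmb κ (closureEmb (K := ℚ) (v.adicCompletion ℚ)) W →+ ℤ_[2]))
    (J : letI := moduleOfGenerator κ (closureEmb (K := ℚ) (v.adicCompletion ℚ)) W hg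
      (localTowerPointsOfEmb κ (closureEmb (K := ℚ) (v.adicCompletion ℚ)) W →+ ℤ_[2]) →ₗ[IwasawaAlgebra 2]
        IwasawaAlgebra 2 × IwasawaAlgebra 2)
    (hJ : ∀ w, IsColemanPair κ (closureEmb (K := ℚ) (v.adicCompletion ℚ)) W ap g c w (J w).1 (J w).2)
    {N : ℕ} (f : CuspForm (Gamma0 N) 2) (ϖ : ℚ) (Ls Lf : IwasawaAlgebra 2) (hL : IsSprungPair f 2 ap Ls Lf)
    {ι : Type*} (x : ι → I.H) (A : ι → IwasawaAlgebra 2) {d : ℤ_[2]} (hd : d ≠ 0)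
    (hE3 : ∀ (i : ι) (n : ℕ), ∃ (m : ℕ) (q : IwasawaAlgebra 2), PowerSeries.C ((2 : ℚ_[2]) ^ m) *
        (iwasawaToPowerSeries 2 (A i) * (((mazurTateElement f 2 n).map (algebraMap ℚ ℚ_[2]) : ℚ_[2][X]) : PowerSeries ℚ_[2]) -
          iwasawaToPowerSeries 2 (PowerSeries.C d *
            pairingSum W (localTowerPointsOfEmb κ (closureEmb (K := ℚ) (v.adicCompletion ℚ)) W) g n (c n) (L (x i)))) =
      iwasawaToPowerSeries 2 ((((cyclotomicOmega 2 n).map (Int.castRingHom ℤ_[2]) : ℤ_[2][X]) : PowerSeries ℤ_[2]) * q))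
    (hcop : ∀ 𝔭 : PrimeSpectrum (IwasawaAlgebra 2), 𝔭.asIdeal.height = 1 →
      PowerSeries.C (2 : ℤ_[2]) ∉ 𝔭.asIdeal → ∃ i, A i ∉ 𝔭.asIdeal ∧
        Literature.NumberTheory.EllipticCurves.Kato2004.IsEulerSystemClassTwo W hκ I (x i) ∧ x i ≠ 0)
    (h2 : ∀ 𝔭 : PrimeSpectrum (IwasawaAlgebra 2), 𝔭.asIdeal.height = 1 →
      PowerSeries.C (2 : ℤ_[2]) ∈ 𝔭.asIdeal → ∃ i, A i ∉ 𝔭.asIdeal)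
    (hLμ : Lf ∉ augIdealP 2) :
    ((∃ t : ℤ_[2], (t : ℚ_[2]) = (ϖ : ℚ_[2]) * (d : ℚ_[2])) ↔ 0 ≤ padicValRat 2 ϖ) ∧
      ∀ t : ℤ_[2], (t : ℚ_[2]) = (ϖ : ℚ_[2]) * (d : ℚ_[2]) → (t : ℚ_[2]).valuation = padicValRat 2 ϖ := by
  have hdU := isUnit_d_of_h2 W v hκ hg hap I L J hJ f Ls Lf hL x A hd hE3 hcop h2 hLμ
  exact ⟨exists_padicInt_coe_eq_mul_iff_of_isUnit hdU ϖ, fun t ht ↦ valuation_eq_padicValRat_of_isUnit hdU ht⟩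

omit [W.IsGloballyMinimal] in
/-- ★ **`h2` IS ♭-PRIMITIVITY OF THE FAMILY on the habitat**: under `μ(L♭) = 0`, the displayed `h2` of the F3 assembly yields a class
`x_δ` of the family whose ♭-Coleman image `(J (L x_δ)).2` is NOT divisible by `2`, and for every `δ`, `A_δ ∉ (2) ⟺ (J (L x_δ)).2 ∉ (2)`.
[cite: Kato2004Asterisque, Thm. 12.5 (4), Thm. 12.6 (p. 222), §13.12–13.14 (pp. 231–234)] [cite: Sprung2012, Def. 7.1, Thm. 7.14] -/
theorem h2_iff_flatPrimitive
    (hκ : κ.IsCyclotomic) (hg : κ.IsTopGenerator (resGalOfEmb (closureEmb (K := ℚ) (v.adicCompletion ℚ)) g)) {ap : ℤ} (hap : (2 : ℤ) ∣ ap)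
    (I : Kato2004.IwasawaH1Data W 2 κ γ)
    (L : letI := moduleOfGenerator κ (closureEmb (K := ℚ) (v.adicCompletion ℚ)) W hg
      I.H →ₗ[IwasawaAlgebra 2] (localTowerPointsOfEmb κ (closureEmb (K := ℚ) (v.adicCompletion ℚ)) W →+ ℤ_[2]))
    (J : letI := moduleOfGenerator κ (closureEmb (K := ℚ) (v.adicCompletion ℚ)) W hg
      (localTowerPointsOfEmb κ (closureEmb (K := ℚ) (v.adicCompletion ℚ)) W →+ ℤ_[2]) →ₗ[IwasawaAlgebra 2]
        IwasawaAlgebra 2 × IwasawaAlgebra 2)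
    (hJ : ∀ w, IsColemanPair κ (closureEmb (K := ℚ) (v.adicCompletion ℚ)) W ap g c w (J w).1 (J w).2)
    {N : ℕ} (f : CuspForm (Gamma0 N) 2) (Ls Lf : IwasawaAlgebra 2) (hL : IsSprungPair f 2 ap Ls Lf)
    {ι : Type*} (x : ι → I.H) (A : ι → IwasawaAlgebra 2) {d : ℤ_[2]} (hd : d ≠ 0)
    (hE3 : ∀ (i : ι) (n : ℕ), ∃ (m : ℕ) (q : IwasawaAlgebra 2), PowerSeries.C ((2 : ℚ_[2]) ^ m) *
        (iwasawaToPowerSeries 2 (A i) * (((mazurTateElement f 2 n).map (algebraMap ℚ ℚ_[2]) : ℚ_[2][X]) : PowerSeries ℚ_[2]) -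
          iwasawaToPowerSeries 2 (PowerSeries.C d *
            pairingSum W (localTowerPointsOfEmb κ (closureEmb (K := ℚ) (v.adicCompletion ℚ)) W) g n (c n) (L (x i)))) =
      iwasawaToPowerSeries 2 ((((cyclotomicOmega 2 n).map (Int.castRingHom ℤ_[2]) : ℤ_[2][X]) : PowerSeries ℤ_[2]) * q))
    (hcop : ∀ 𝔭 : PrimeSpectrum (IwasawaAlgebra 2), 𝔭.asIdeal.height = 1 →
      PowerSeries.C (2 : ℤ_[2]) ∉ 𝔭.asIdeal → ∃ i, A i ∉ 𝔭.asIdeal ∧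
        Literature.NumberTheory.EllipticCurves.Kato2004.IsEulerSystemClassTwo W hκ I (x i) ∧ x i ≠ 0)
    (h2 : ∀ 𝔭 : PrimeSpectrum (IwasawaAlgebra 2), 𝔭.asIdeal.height = 1 →
      PowerSeries.C (2 : ℤ_[2]) ∈ 𝔭.asIdeal → ∃ i, A i ∉ 𝔭.asIdeal)
    (hLμ : Lf ∉ augIdealP 2) :
    (∃ i, (J (L (x i))).2 ∉ augIdealP 2) ∧ ∀ i, (J (L (x i))).2 ∉ augIdealP 2 ↔ A i ∉ augIdealP 2 := by
  have hcop' : ∀ 𝔭 : PrimeSpectrum (IwasawaAlgebra 2), 𝔭.asIdeal.height = 1 →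
      PowerSeries.C ((2 : ℕ) : ℤ_[2]) ∉ 𝔭.asIdeal → ∃ i, A i ∉ 𝔭.asIdeal := fun 𝔭 h𝔭 hm ↦ by
    obtain ⟨i, hi, -, -⟩ := hcop 𝔭 h𝔭 (by simpa using hm)
    exact ⟨i, hi⟩
  have h2' : ∀ 𝔭 : PrimeSpectrum (IwasawaAlgebra 2), 𝔭.asIdeal.height = 1 →
      PowerSeries.C ((2 : ℕ) : ℤ_[2]) ∈ 𝔭.asIdeal → ∃ i, A i ∉ 𝔭.asIdeal := fun 𝔭 h𝔭 hm ↦ h2 𝔭 h𝔭 (by simpa using hm)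
  have hE3' : ∀ (i : ι) (n : ℕ), ∃ (m : ℕ) (q : IwasawaAlgebra 2), PowerSeries.C (((2 : ℕ) : ℚ_[2]) ^ m) *
        (iwasawaToPowerSeries 2 (A i) * (((mazurTateElement f 2 n).map (algebraMap ℚ ℚ_[2]) : ℚ_[2][X]) : PowerSeries ℚ_[2]) -
          iwasawaToPowerSeries 2 (PowerSeries.C d *
            pairingSum W (localTowerPointsOfEmb κ (closureEmb (K := ℚ) (v.adicCompletion ℚ)) W) g n (c n) (L (x i)))) =
      iwasawaToPowerSeries 2 ((((cyclotomicOmega 2 n).map (Int.castRingHom ℤ_[2]) : ℤ_[2][X]) : PowerSeries ℤ_[2]) * q) :=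
    fun i n ↦ by simpa only [Nat.cast_ofNat] using hE3 i n
  have hap' : ((2 : ℕ) : ℤ) ∣ ap := by simpa using hap
  exact ⟨exists_coleman_flat_not_mem_of_family hg hap' L J hJ x A hd hcop' h2' f hE3' hL hLμ,
    coleman_flat_not_mem_iff_of_family hg hap' L J hJ x A hd hcop' h2' f hE3' hL hLμ⟩

end Habitat

end SSFlatERL

end Summit.BirchSwinnertonDyer.BirchSwinnertonDyer.Theorems

end
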